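import Summits.NavierStokesRegularity.NavierStokesRegularity.Theorems.SymmetryModuliCountLinearLiouvilleSevenGaugeBounds
import Summits.NavierStokesRegularity.NavierStokesRegularity.Theorems.TypeICertificateLadderTargetHeadFluxCriterion
import Summits.NavierStokesRegularity.NavierStokesRegularity.Theorems.RellichScarSymmetricScarExistsGaussianWindowLawLemmas
import Literature.Analysis.FluidPDE.TypeIAncientMildClassical
import Literature.Analysis.FluidPDE.AncientSimilarityVariables
import Literature.Analysis.FluidPDE.CaloricRemainderCalculus
import Literature.Analysis.FluidPDE.SpaceTimeCalculus
import Literature.Analysis.FluidPDE.ClassicalSolutionGlue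
import HarnessLib

/-!
# Crux `NoTypeIBlowup` (stmt-NavierStokesRegularity-1217), line `head-flux-channel`:
  STUB S2b, continuity of the head-flux channel (`stub_gaussianChannelContinuous`)

-- adapted from Cruxes/Target/S2bProof.lean (refuter-drefute), copied, not imported; the three
-- class-uniform KNSS gauge bounds are IMPORTED from the accepted GaugeBounds / GaugeStrainBound files.

`stub_gaussianChannelContinuous`: for a Type-I ancient mild field `u` (`IsTypeIAncientMild C u`),
ANY classical pressure `p` of `u` on `(−∞, 0)` (`IsClassicalNSSolutionOn (Iio 0) 1 0 u p`), and the
backward similarity variables `U = lerayOrbit u`, `P = lerayOrbitPressure p`, the head-flux channel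
`Ch(s) = ∫ (½‖U‖² + P)⟪y, U⟫ e^{−‖y‖²/4} dy` is continuous in `s`.

Ingredients, all accepted tree facts:

* the three CLASS-UNIFORM KNSS gauge bounds `(−t)‖∇u‖ ≤ K₀`, `√(−t)³‖Δu‖ ≤ K₂`,
  `√(−t)³‖∂ₜu‖ ≤ L` (KNSS 2009 Prop. 4.1 / (4.10)–(4.11) on the window `[−2, −1/2)` transported
  by the Navier–Stokes zoom; tree `exists_gauge_norm_fderiv_le_of_typeI`,
  `exists_gauge_norm_laplacian_le_of_typeI`, `exists_gauge_norm_timeDeriv_le_of_typeI`); whence for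
  ANY classical pressure
  `√(−t)³‖∇p(t, x)‖ ≤ K₂ + L + K₀ C` (`∇p = Δu − ∂ₜu − (u·∇)u`, `IsClassicalNSSolutionOn.momentum`);
* `gradient_lerayOrbitPressure`: `∇P(s)(y) = e^{−3s/2} ∇p(t)(x)`, so `‖∇P‖ ≤ C₃` GLOBALLY, and by
  the mean value inequality `|P(s, y)| ≤ |P(s, 0)| + C₃‖y‖` (LINEAR GROWTH, locally uniform in `s`);
* joint smoothness of `U`, `P` on `ℝ × ℝ³` (`isClassicalNSSolutionOn_Iio_iff_isBackwardLeraySolutionOn`),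
  `‖U‖ ≤ C`, and `continuousAt_of_dominated` with the bound `M (1 + ‖y‖)² e^{−‖y‖²/4}` for
  `s ∈ [s₀ − 1, s₀ + 1]` (`M` from a bound of the continuous `s ↦ |P(s, 0)|` there).

Lands `--supports stmt-NavierStokesRegularity-1217`.

## References

* G. Koch, N. Nadirashvili, G. Seregin, V. Šverák, *Liouville theorems for the Navier–Stokes
  equations and applications*, Acta Math. 203 (2009), §1 (1.2), Prop. 4.1, (4.10)–(4.11)
  [KochNadirashviliSereginSverak2009].
-/

noncomputable section

namespace Summit.NavierStokesRegularity.NavierStokesRegularity.Theorems.HeadFluxChannelS2b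

open MeasureTheory Set Filter Topology Function
open scoped RealInnerProductSpace Laplacian ContDiff
open Literature.Analysis Literature.Analysis.FluidPDE
open Literature.Analysis.FluidPDE.PineauVicol2026
open Summit.NavierStokesRegularity.NavierStokesRegularity.Theorems
open Summit.NavierStokesRegularity.NavierStokesRegularity.Theorems.SymmetricScarExists.LogtimeBernoulli

/-! ### Pressure-gradient bound for ANY classical pressure; linear growth in similarity variables -/

/-- **Scale-invariant pressure-gradient bound for ANY classical pressure of a class member**:
`√(−t)³ ‖∇p(t, x)‖ ≤ K₂ + L + K₀ C` (`∇p = Δu − ∂ₜu − (u·∇)u` and the three class-uniform gauge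
bounds). [cite: KochNadirashviliSereginSverak2009, Prop. 4.1 (4.10)–(4.11) (arXiv:0709.3599 p. 8)] -/
theorem exists_norm_gradient_pressure_le {C : ℝ}
    {u : ℝ → EuclideanSpace ℝ (Fin 3) → EuclideanSpace ℝ (Fin 3)}
    {p : ℝ → EuclideanSpace ℝ (Fin 3) → ℝ} (hu : IsTypeIAncientMild C u)
    (hp : IsClassicalNSSolutionOn (Iio 0) 1 0 u p) :
    ∃ C₃ : ℝ, ∀ t < 0, ∀ x, Real.sqrt (-t) ^ 3 * ‖gradient (p t) x‖ ≤ C₃ := by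
  obtain ⟨K₀, hK₀⟩ := exists_gauge_norm_fderiv_le_of_typeI C
  obtain ⟨K₂, hK₂⟩ := exists_gauge_norm_laplacian_le_of_typeI C
  obtain ⟨L, hL⟩ := exists_gauge_norm_timeDeriv_le_of_typeI C
  refine ⟨K₂ + L + K₀ * C, fun t ht x => ?_⟩
  have hmom : timeDeriv u t x + convect (u t) (u t) x = (Δ (u t)) x - gradient (p t) x := by
    have h := hp.momentum t ht x
    rw [timeDerivWithin_eq_deriv isOpen_Iio ht, ← timeDeriv_apply, one_smul, Pi.zero_apply,
      Pi.zero_apply, add_zero] at h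
    exact h
  have hnt : 0 < -t := neg_pos.2 ht
  have hst : 0 < Real.sqrt (-t) := Real.sqrt_pos.2 hnt
  have hs3 : 0 < Real.sqrt (-t) ^ 3 := by positivity
  have hsq : Real.sqrt (-t) ^ 2 = -t := Real.sq_sqrt hnt.le
  have hs3eq : Real.sqrt (-t) ^ 3 = (-t) * Real.sqrt (-t) := by rw [pow_succ, hsq]
  have e : gradient (p t) x = (Δ (u t)) x - timeDeriv u t x - convect (u t) (u t) x := by
    rw [sub_sub, hmom]; abel
  have h1 : Real.sqrt (-t) ^ 3 * ‖(Δ (u t)) x‖ ≤ K₂ := hK₂ hu t ht x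
  have h2 : Real.sqrt (-t) ^ 3 * ‖timeDeriv u t x‖ ≤ L := hL hu t ht x
  have h3 : Real.sqrt (-t) ^ 3 * ‖convect (u t) (u t) x‖ ≤ K₀ * C := by
    have hDu : (-t) * ‖fderiv ℝ (u t) x‖ ≤ K₀ := hK₀ hu t ht x
    have hu0 : ‖u t x‖ ≤ C / Real.sqrt (-t) := hu.norm_le ht x
    have hu1 : Real.sqrt (-t) * ‖u t x‖ ≤ C := by
      rw [le_div_iff₀ hst] at hu0
      linarith [mul_comm (Real.sqrt (-t)) ‖u t x‖]
    have hK00 : 0 ≤ K₀ := (mul_nonneg hnt.le (norm_nonneg _)).trans hDu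
    calc Real.sqrt (-t) ^ 3 * ‖convect (u t) (u t) x‖
        = Real.sqrt (-t) ^ 3 * ‖fderiv ℝ (u t) x (u t x)‖ := by rw [convect_apply]
      _ ≤ Real.sqrt (-t) ^ 3 * (‖fderiv ℝ (u t) x‖ * ‖u t x‖) :=
          mul_le_mul_of_nonneg_left (ContinuousLinearMap.le_opNorm _ _) hs3.le
      _ = ((-t) * ‖fderiv ℝ (u t) x‖) * (Real.sqrt (-t) * ‖u t x‖) := by rw [hs3eq]; ring
      _ ≤ K₀ * C := mul_le_mul hDu hu1 (by positivity) hK00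
  have hnorm : ‖gradient (p t) x‖ ≤
      ‖(Δ (u t)) x‖ + ‖timeDeriv u t x‖ + ‖convect (u t) (u t) x‖ := by
    rw [e]; exact (norm_sub_le _ _).trans (add_le_add (norm_sub_le _ _) le_rfl)
  have hmul := mul_le_mul_of_nonneg_left hnorm hs3.le
  rw [mul_add, mul_add] at hmul
  linarith

/-- **Global gradient bound for the similarity pressure**: `‖∇P(s)(y)‖ ≤ C₃` for
`P = lerayOrbitPressure p` (`∇P(s)(y) = e^{−3s/2} ∇p(−e^{−s})(e^{−s/2}y)`,
`gradient_lerayOrbitPressure`, `e^{−3s/2} = √(−t)³`). [folklore] -/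
theorem exists_norm_gradient_lerayOrbitPressure_le {C : ℝ}
    {u : ℝ → EuclideanSpace ℝ (Fin 3) → EuclideanSpace ℝ (Fin 3)}
    {p : ℝ → EuclideanSpace ℝ (Fin 3) → ℝ} (hu : IsTypeIAncientMild C u)
    (hp : IsClassicalNSSolutionOn (Iio 0) 1 0 u p) :
    ∃ C₃ : ℝ, 0 ≤ C₃ ∧ ∀ s y, ‖gradient (lerayOrbitPressure p s) y‖ ≤ C₃ := by
  obtain ⟨C₃, hC₃⟩ := exists_norm_gradient_pressure_le hu hp
  refine ⟨C₃, ?_, fun s y => ?_⟩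
  · have h := hC₃ (-1) (by norm_num) 0
    exact (mul_nonneg (by positivity) (norm_nonneg _)).trans h
  · have ht : -Real.exp (-s) < 0 := neg_neg_of_pos (Real.exp_pos _)
    have h := hC₃ _ ht (Real.exp (-s / 2) • y)
    rw [neg_neg, sqrt_exp_neg] at h
    rw [gradient_lerayOrbitPressure, lerayOrbitForce_apply, norm_smul,
      Real.norm_of_nonneg (by positivity)]
    exact h

/-- **Linear growth of the similarity pressure**: `|P(s, y)| ≤ |P(s, 0)| + C₃ ‖y‖`
(mean value inequality with the global gradient bound). [folklore] -/
theorem abs_lerayOrbitPressure_le {C : ℝ}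
    {u : ℝ → EuclideanSpace ℝ (Fin 3) → EuclideanSpace ℝ (Fin 3)}
    {p : ℝ → EuclideanSpace ℝ (Fin 3) → ℝ} (hu : IsTypeIAncientMild C u)
    (hp : IsClassicalNSSolutionOn (Iio 0) 1 0 u p) :
    ∃ C₃ : ℝ, 0 ≤ C₃ ∧ ∀ s y,
      |lerayOrbitPressure p s y| ≤ |lerayOrbitPressure p s 0| + C₃ * ‖y‖ := by
  obtain ⟨C₃, hC₃0, hC₃⟩ := exists_norm_gradient_lerayOrbitPressure_le hu hp
  have hP : IsSmoothSpaceTimeOn univ (lerayOrbitPressure p) :=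
    (isClassicalNSSolutionOn_Iio_iff_isBackwardLeraySolutionOn.1 hp).smooth_pressure
  refine ⟨C₃, hC₃0, fun s y => ?_⟩
  have hd : ∀ z ∈ (univ : Set (EuclideanSpace ℝ (Fin 3))),
      DifferentiableAt ℝ (lerayOrbitPressure p s) z := fun z _ =>
    ((hP.contDiff_slice (mem_univ s)).differentiable (by simp)).differentiableAt
  have hb : ∀ z ∈ (univ : Set (EuclideanSpace ℝ (Fin 3))),
      ‖fderiv ℝ (lerayOrbitPressure p s) z‖ ≤ C₃ := fun z _ => by
    have e : ‖gradient (lerayOrbitPressure p s) z‖ = ‖fderiv ℝ (lerayOrbitPressure p s) z‖ := by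
      rw [gradient, LinearIsometryEquiv.norm_map]
    rw [← e]; exact hC₃ s z
  have hmv := Convex.norm_image_sub_le_of_norm_fderiv_le hd hb convex_univ (mem_univ 0) (mem_univ y)
  rw [sub_zero, Real.norm_eq_abs] at hmv
  have htri : |lerayOrbitPressure p s y| ≤
      |lerayOrbitPressure p s 0| + |lerayOrbitPressure p s y - lerayOrbitPressure p s 0| := by
    have := abs_add_le (lerayOrbitPressure p s 0) (lerayOrbitPressure p s y - lerayOrbitPressure p s 0)
    rwa [add_sub_cancel] at this
  linarith

/-! ### The abstract continuity statement -/

/-- **Continuity of the head-flux channel for bounded `U` and linearly growing `P`**, both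
jointly smooth on `ℝ × ℝ³`: dominated convergence locally in `s` with the bound
`M (1 + ‖y‖)² e^{−‖y‖²/4}`. [folklore] -/
theorem continuous_channel_of_linearGrowth
    {U : ℝ → EuclideanSpace ℝ (Fin 3) → EuclideanSpace ℝ (Fin 3)}
    {P : ℝ → EuclideanSpace ℝ (Fin 3) → ℝ}
    (hU : IsSmoothSpaceTimeOn univ U) (hP : IsSmoothSpaceTimeOn univ P) {C C₃ : ℝ}
    (hC : 0 ≤ C) (hC₃ : 0 ≤ C₃) (hUC : ∀ s y, ‖U s y‖ ≤ C)
    (hlin : ∀ s y, |P s y| ≤ |P s 0| + C₃ * ‖y‖) :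
    Continuous (fun s : ℝ =>
      ∫ y, (‖U s y‖ ^ 2 / 2 + P s y) * ⟪y, U s y⟫ * Real.exp (-‖y‖ ^ 2 / 4)) := by
  have hmeas : ∀ s, AEStronglyMeasurable
      (fun y => (‖U s y‖ ^ 2 / 2 + P s y) * ⟪y, U s y⟫ * Real.exp (-‖y‖ ^ 2 / 4)) volume := by
    intro s
    have cU : Continuous (U s) := (hU.contDiff_slice (mem_univ s)).continuous
    have cP : Continuous (P s) := (hP.contDiff_slice (mem_univ s)).continuous
    have cG : Continuous fun y : EuclideanSpace ℝ (Fin 3) => Real.exp (-‖y‖ ^ 2 / 4) :=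
      continuous_gaussWeight
    exact ((((cU.norm.pow 2).div_const 2).add cP).mul (continuous_id.inner cU)).mul cG
      |>.aestronglyMeasurable
  have hcont : ∀ y, Continuous fun s =>
      (‖U s y‖ ^ 2 / 2 + P s y) * ⟪y, U s y⟫ * Real.exp (-‖y‖ ^ 2 / 4) := by
    intro y
    have cU : Continuous fun s => U s y := continuous_timeLine hU y
    have cP : Continuous fun s => P s y := continuous_timeLine hP y
    exact ((((cU.norm.pow 2).div_const 2).add cP).mul (continuous_const.inner cU)).mul
      continuous_const
  refine continuous_iff_continuousAt.2 fun s₀ => ?_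
  -- a bound for `|P(s, 0)|` on `[s₀ - 1, s₀ + 1]`
  obtain ⟨M₀, hM₀⟩ := (isCompact_Icc (a := s₀ - 1) (b := s₀ + 1)).exists_bound_of_continuousOn
    ((continuous_timeLine hP (0 : EuclideanSpace ℝ (Fin 3))).continuousOn)
  have hM₀0 : 0 ≤ M₀ := (norm_nonneg _).trans (hM₀ s₀ ⟨by linarith, by linarith⟩)
  -- the domination on the neighbourhood
  have hdom : ∀ s ∈ Icc (s₀ - 1) (s₀ + 1), ∀ y,
      ‖(‖U s y‖ ^ 2 / 2 + P s y) * ⟪y, U s y⟫ * Real.exp (-‖y‖ ^ 2 / 4)‖ ≤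
        (C ^ 2 / 2 + M₀ + C₃) * C * (1 + ‖y‖) ^ 2 * gaussWeight y := by
    intro s hs y
    have hy0 : 0 ≤ ‖y‖ := norm_nonneg y
    have hg0 : 0 < gaussWeight y := gaussWeight_pos y
    have hUy : ‖U s y‖ ≤ C := hUC s y
    have hP0 : |P s 0| ≤ M₀ := by
      have h := hM₀ s hs
      rwa [Real.norm_eq_abs] at h
    have hPy : |P s y| ≤ M₀ + C₃ * ‖y‖ := (hlin s y).trans (by linarith)
    have hhead : |‖U s y‖ ^ 2 / 2 + P s y| ≤ (C ^ 2 / 2 + M₀ + C₃) * (1 + ‖y‖) := by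
      have h1 : |‖U s y‖ ^ 2 / 2| ≤ C ^ 2 / 2 := by
        rw [abs_of_nonneg (by positivity)]
        have := pow_le_pow_left₀ (norm_nonneg _) hUy 2
        linarith
      have h2 := (abs_add_le _ _).trans (add_le_add h1 hPy)
      have h3 : C ^ 2 / 2 + (M₀ + C₃ * ‖y‖) ≤ (C ^ 2 / 2 + M₀ + C₃) * (1 + ‖y‖) := by
        nlinarith [sq_nonneg C, hM₀0, hC₃, hy0]
      exact h2.trans h3
    have hinner : |⟪y, U s y⟫| ≤ (1 + ‖y‖) * C :=
      (abs_real_inner_le_norm _ _).trans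
        (mul_le_mul (by linarith) hUy (norm_nonneg _) (by positivity))
    rw [Real.norm_eq_abs, abs_mul, abs_mul, abs_of_pos (Real.exp_pos _)]
    have hprod := mul_le_mul hhead hinner (abs_nonneg _) (by positivity)
    calc |‖U s y‖ ^ 2 / 2 + P s y| * |⟪y, U s y⟫| * Real.exp (-‖y‖ ^ 2 / 4)
        ≤ ((C ^ 2 / 2 + M₀ + C₃) * (1 + ‖y‖)) * ((1 + ‖y‖) * C) * Real.exp (-‖y‖ ^ 2 / 4) :=
          mul_le_mul_of_nonneg_right hprod (Real.exp_pos _).le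
      _ = (C ^ 2 / 2 + M₀ + C₃) * C * (1 + ‖y‖) ^ 2 * gaussWeight y := by
          rw [gaussWeight]; ring
  refine continuousAt_of_dominated
    (bound := fun y => (C ^ 2 / 2 + M₀ + C₃) * C * (1 + ‖y‖) ^ 2 * gaussWeight y)
    (Eventually.of_forall hmeas) ?_ ?_ (Eventually.of_forall fun y => (hcont y).continuousAt)
  · filter_upwards [Icc_mem_nhds (show s₀ - 1 < s₀ by linarith) (show s₀ < s₀ + 1 by linarith)]
      with s hs
    exact Eventually.of_forall (hdom s hs)
  · refine integrable_of_norm_le_mul_gaussWeight (M := (C ^ 2 / 2 + M₀ + C₃) * C) ?_ 2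
      fun y => ?_
    · exact ((continuous_const.mul ((continuous_const.add continuous_norm).pow 2)).mul
        continuous_gaussWeight).aestronglyMeasurable
    · rw [Real.norm_of_nonneg]
      have := gaussWeight_pos y
      positivity

end Summit.NavierStokesRegularity.NavierStokesRegularity.Theorems.HeadFluxChannelS2b

/-! ## The stub -/

namespace Summit.NavierStokesRegularity.NavierStokesRegularity.Theorems

open MeasureTheory Set Filter Topology
open scoped RealInnerProductSpace
open Literature.Analysis.FluidPDE

/-- **stub_gaussianChannelContinuous** (S2b, line `head-flux-channel` of crux `NoTypeIBlowup`)
— continuity of the head-flux channel `s ↦ ∫ (½‖U‖² + P)⟪y, U⟫ e^{−‖y‖²/4}` along the Leray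
orbit `U = lerayOrbit u`, `P = lerayOrbitPressure p` of a Type-I ancient mild field `u` with ANY
classical pressure `p` on `(−∞, 0)` (dominated convergence with `‖U‖ ≤ C`, the linear growth
`|P(s, y)| ≤ |P(s, 0)| + C₃‖y‖` from the class-uniform KNSS gauge bounds, and joint smoothness of
`U`, `P`). [folklore] -/
theorem stub_gaussianChannelContinuous :
    ∀ (C : ℝ) (u : ℝ → EuclideanSpace ℝ (Fin 3) → EuclideanSpace ℝ (Fin 3))
      (p : ℝ → EuclideanSpace ℝ (Fin 3) → ℝ),
      IsTypeIAncientMild C u → IsClassicalNSSolutionOn (Set.Iio 0) 1 0 u p →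
      Continuous (fun s : ℝ =>
          ∫ y, (‖lerayOrbit u s y‖ ^ 2 / 2 + lerayOrbitPressure p s y) *
            ⟪y, lerayOrbit u s y⟫ * Real.exp (-‖y‖ ^ 2 / 4)) := by
  intro C u p hu hp
  have hBL := isClassicalNSSolutionOn_Iio_iff_isBackwardLeraySolutionOn.1 hp
  obtain ⟨C₃, hC₃0, hlin⟩ := HeadFluxChannelS2b.abs_lerayOrbitPressure_le hu hp
  exact HeadFluxChannelS2b.continuous_channel_of_linearGrowth hBL.smooth_velocity
    hBL.smooth_pressure hu.nonneg hC₃0 (headFlux_norm_lerayOrbit_le hu) hlin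

end Summit.NavierStokesRegularity.NavierStokesRegularity.Theorems

end
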